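import Mathlib
import Summits.ResolutionOfSingularities.ResolutionOfSingularities.Theorems.WeightedInvariantLocalWeightedDropNCResSettingHeadDrop
import Summits.ResolutionOfSingularities.ResolutionOfSingularities.Theorems.WeightedInvariantLocalWeightedDropNCGameBWinsDefs

/-!
# `WeightedInvariant.LocalWeightedDrop` ENGINE, W′|₄ line — D₃ᴮ object (6): THE HEAD-DROP ONE-STEPS IN B-PERMISSIBLE FORM (tools for hands B and D)

Sub-problem `ResolutionOfSingularities`, ENGINE crux `stmt-ResolutionOfSingularities-8899` (`LocalWeightedDrop`), registered stub W′|₄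
`stub_wildWideApexFourStartsWon`; res-L1-w43-plan-1 RULING 2026-08-27T21:45:42Z (D₃ᴮ lane).  [OURS · L1 W4.3 · chain w43 · res-L1-w43-lead-1 g6; def-free;
the one-move head-drop lemmas of res-L1-w43-stub-1's …NCResSettingHeadDrop RE-THREADED over `DBWinsTo` (p575221) — there the move is a HYPOTHESISED
B-permissible move and the successor decoration is the transform, so the B-form is the same proof.  None of them assumes `2 ≤ o`: they serve the
apex-column regime (hand B) AND the `o = 1` endgame (hand D) of the D₃ᴮ order of record.  Nothing here is a statement of any manuscript; AI-produced,
gate-checked, weaker than expert review.]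

* `bmoveClause_headDrop_of_orderDrop`, `dbWinsTo_headDrop_of_orderDrop` — one B-permissible move all of whose `g`-answers are non-near B-wins «head drop»;
* `dbWinsTo_headDrop_of_apexTrivial` — regime E0 (trivial apex of `in_c (f·∏_O x_l)`): the identity point blow-up;
* `dbWinsTo_headDrop_of_apexLine_axis` — apex dimension `≤ 1` with a permissible coordinate axis: the move `(X, 𝟙_S)`.
-/

set_option linter.dupNamespace false -- mandated namespace of this single-conjunct summit

noncomputable section

namespace Summit.ResolutionOfSingularities.ResolutionOfSingularities.Theorems

namespace TameFourTupleDrop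

open MvPowerSeries Literature.AlgebraicGeometry.Resolution

variable {k : Type} [Field k] {m : ℕ}

/-! ## Decorated packaging in B-form: one B-permissible move all of whose g-answers are non-near -/

/-- **THE B-MOVE CLAUSE OF A HEAD-DROPPING MOVE** (re-thread of `moveClause_headDrop_of_orderDrop`, whose successor witness IS the transform).  From an admissibly decorated position, a B-permissible move ALL of whose g-answers are
non-near (at every exceptional point, every `s`-saturation of the transform of `g = f·∏_O x_l` and every live slot: sliced order `< c`)
satisfies the move clause for «admissibly decorated with strictly smaller head» (any live slot; the transform supplies the decoration). -/
theorem bmoveClause_headDrop_of_orderDrop {b : MvPowerSeries (Fin (m + 1)) k} {δ : Decoration k m}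
    {Φ : Fin (m + 1) → MvPowerSeries (Fin (m + 1)) k} {w : Fin (m + 1) → ℕ} (hadm : Admissible b δ) (hperm : IsBPermissible δ Φ w)
    (hdrop : ∀ c : Fin (m + 1) → k, (∀ l, w l = 0 → c l = 0) → c ≠ 0 →
      ∀ (A : ℕ) (G : MvPowerSeries (Fin (m + 1 + 1)) k),
        subst (CobordantChart.chart w c) (subst Φ (δ.f * ∏ l ∈ δ.O, X l)) = X 0 ^ A * G → ¬ X 0 ∣ G →
        ∀ i, c i ≠ 0 → (TupleGame.slice i G).order < (δ.c : ℕ∞)) :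
    BMoveClause (b, δ) Φ w (fun τ' => Admissible τ'.1 τ'.2 ∧ τ'.2.head < δ.head) := by
  intro c hc hc0 A G hfac hG
  obtain ⟨i, hci⟩ : ∃ i, c i ≠ 0 := Function.ne_iff.mp hc0
  have hf : δ.f ≠ 0 := hadm.2.1.ne_zero
  obtain ⟨H, U, hfacH, hH, -, -⟩ := Decoration.totalO_chart_eq hperm hc hf hci
  exact ⟨i, hci, admissible_transform hadm hperm hc hfac hG hci,
    Decoration.head_transform_lt_of_order_slice_lt hadm hperm hc hci hfacH hH (hdrop c hc hc0 _ H hfacH hH i hci)⟩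

/-- **ONE HEAD-DROPPING B-PERMISSIBLE MOVE B-WINS THE HEAD PHASE** (decorated `DBWinsTo` form, the currency of `…NCResPhaseAssemblyB`): from an admissibly decorated position with a B-permissible move all of whose g-answers are non-near, the mover forces
«admissibly decorated of strictly smaller head» — in one move. -/
theorem dbWinsTo_headDrop_of_orderDrop {b : MvPowerSeries (Fin (m + 1)) k} {δ : Decoration k m}
    {Φ : Fin (m + 1) → MvPowerSeries (Fin (m + 1)) k} {w : Fin (m + 1) → ℕ} (hadm : Admissible b δ) (hperm : IsBPermissible δ Φ w)
    (hdrop : ∀ c : Fin (m + 1) → k, (∀ l, w l = 0 → c l = 0) → c ≠ 0 →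
      ∀ (A : ℕ) (G : MvPowerSeries (Fin (m + 1 + 1)) k),
        subst (CobordantChart.chart w c) (subst Φ (δ.f * ∏ l ∈ δ.O, X l)) = X 0 ^ A * G → ¬ X 0 ∣ G →
        ∀ i, c i ≠ 0 → (TupleGame.slice i G).order < (δ.c : ℕ∞)) :
    DBWinsTo (fun τ : MvPowerSeries (Fin (m + 1)) k × Decoration k m => Admissible τ.1 τ.2 ∧ τ.2.head < δ.head) (b, δ) := by
  refine DBWinsTo.of_measure ({(b, δ)} : Set (MvPowerSeries (Fin (m + 1)) k × Decoration k m)) (fun _ => 0) ?_ (Set.mem_singleton _)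
  intro τ hτ _
  rw [Set.mem_singleton_iff] at hτ
  subst hτ
  exact ⟨Φ, w, hperm, (bmoveClause_headDrop_of_orderDrop hadm hperm hdrop).mono fun τ' hτ' => Or.inl hτ'⟩

/-! ## Regime E0: trivial apex -/

/-- **REGIME E0 (apex of `in_c g` trivial) B-WINS THE HEAD PHASE IN ONE MOVE** (OURS · L1 W4.3; re-thread of `dWinsTo_headDrop_of_apexTrivial`; no
hypothesis on `o` — usable in the `o = 1` endgame too): the identity point move
is B-permissible for every decoration (`isBPermissible_point_X`), and by res-L1-w43-stub-3's (N1) `TOT2Near.order_slice_lt_of_apexTrivial` applied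
to `g = f · ∏_{l∈O} x_l` (order `c`), every answer is non-near. -/
theorem dbWinsTo_headDrop_of_apexTrivial {b : MvPowerSeries (Fin (m + 1)) k} {δ : Decoration k m} (hadm : Admissible b δ)
    (hapex : ∀ u : Fin (m + 1) → k,
      (∀ v, CobordantChart.initEval (fun _ : Fin (m + 1) => 1) (v + u) δ.c (δ.f * ∏ l ∈ δ.O, X l) =
        CobordantChart.initEval (fun _ : Fin (m + 1) => 1) v δ.c (δ.f * ∏ l ∈ δ.O, X l)) → u = 0) :
    DBWinsTo (fun τ : MvPowerSeries (Fin (m + 1)) k × Decoration k m => Admissible τ.1 τ.2 ∧ τ.2.head < δ.head) (b, δ) := by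
  refine dbWinsTo_headDrop_of_orderDrop hadm (isBPermissible_point_X δ) fun c hc hc0 A G hfac hG i hci => ?_
  have hf : δ.f ≠ 0 := hadm.2.1.ne_zero
  obtain ⟨hA, -⟩ := Decoration.order_slice_totalO_eq (isBPermissible_point_X δ) hc hf hci hfac hG
  subst hA
  rw [show subst (fun j => (X j : MvPowerSeries (Fin (m + 1)) k)) (δ.f * ∏ l ∈ δ.O, X l) = δ.f * ∏ l ∈ δ.O, X l from
    congrFun subst_self _] at hfac
  exact TOT2Near.order_slice_lt_of_apexTrivial _ hapex c i hci hfac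

/-- **THE PERMISSIBLE COORDINATE AXIS AT APEX DIMENSION ≤ 1 B-WINS THE HEAD PHASE IN ONE MOVE** (OURS · L1 W4.3; re-thread of
`dWinsTo_headDrop_of_apexLine_axis`; no hypothesis on `o`): if the coordinate centre
`V(x_j : j ∈ S)` is permissible for `g = f·∏_O x_l` (`c ≤ weightedOrder_{𝟙_S} g`), has a free slot `l₀ ∉ S` (a curve or bigger), and every two
invariance vectors of `in_c g` are dependent (`e(g) ≤ 1`), then the move `(X, 𝟙_S)` is B-permissible and every answer is non-near —
res-L1-w43-stub-3's (N3) `TOT2Near.order_slice_lt_of_apexLine_curve` applied to `g` (the directrix contains the centre's tangent directions, so with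
`e ≤ 1` it IS the tangent line and no near point survives).  The sub-regime «`e(g) = 1`, point ON a permissible curve that is a coordinate axis in
the current letters». -/
theorem dbWinsTo_headDrop_of_apexLine_axis {b : MvPowerSeries (Fin (m + 1)) k} {δ : Decoration k m} (hadm : Admissible b δ)
    {S : Finset (Fin (m + 1))} (hS : S.Nonempty) {l₀ : Fin (m + 1)} (hl₀ : l₀ ∉ S)
    (hP1g : (δ.c : ℕ∞) ≤ (δ.f * ∏ l ∈ δ.O, X l).weightedOrder (fun j => if j ∈ S then 1 else 0))
    (hone : ∀ u₁ u₂ : Fin (m + 1) → k,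
      (∀ v, CobordantChart.initEval (fun _ : Fin (m + 1) => 1) (v + u₁) δ.c (δ.f * ∏ l ∈ δ.O, X l) =
        CobordantChart.initEval (fun _ : Fin (m + 1) => 1) v δ.c (δ.f * ∏ l ∈ δ.O, X l)) →
      (∀ v, CobordantChart.initEval (fun _ : Fin (m + 1) => 1) (v + u₂) δ.c (δ.f * ∏ l ∈ δ.O, X l) =
        CobordantChart.initEval (fun _ : Fin (m + 1) => 1) v δ.c (δ.f * ∏ l ∈ δ.O, X l)) →
      ∃ α β : k, (α ≠ 0 ∨ β ≠ 0) ∧ α • u₁ + β • u₂ = 0) :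
    DBWinsTo (fun τ : MvPowerSeries (Fin (m + 1)) k × Decoration k m => Admissible τ.1 τ.2 ∧ τ.2.head < δ.head) (b, δ) := by
  have hperm := isBPermissible_X_indicator_of_totalO hadm hS hP1g
  refine dbWinsTo_headDrop_of_orderDrop hadm hperm fun c hc hc0 A G hfac hG i hci => ?_
  have hf : δ.f ≠ 0 := hadm.2.1.ne_zero
  obtain ⟨hA, -⟩ := Decoration.order_slice_totalO_eq hperm hc hf hci hfac hG
  subst hA
  rw [show subst (fun j => (X j : MvPowerSeries (Fin (m + 1)) k)) (δ.f * ∏ l ∈ δ.O, X l) = δ.f * ∏ l ∈ δ.O, X l from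
    congrFun subst_self _] at hfac
  exact TOT2Near.order_slice_lt_of_apexLine_curve (fun j => if j ∈ S then 1 else 0) c
    (fun l => by split_ifs <;> simp) hc i hci _ hP1g hone (l := l₀) (if_neg hl₀) hfac

end TameFourTupleDrop

end Summit.ResolutionOfSingularities.ResolutionOfSingularities.Theorems

end
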